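/-
Copyright (c) 2026. All rights reserved.
Released under Apache 2.0 license as described in the file LICENSE.
-/
import Summits.ValiantsHypothesis.ValiantsHypothesis.Theorems.ReadOnceColSparseSupport
import Summits.ValiantsHypothesis.ValiantsHypothesis.Theorems.IsolationRoundsForest
import HarnessLib

/-!
# Read-once determinantal templates with an acyclic free graph: unique completion

`ReadOnceColSparseSupport` (O-L2-19) showed that the support of a READ-ONCE determinantal template
`E : Matrix (Fin r) (Fin r) (M ⊕ F)` with COLUMN-SPARSE non-zero constants is the set of monomials
of its admissible permutations, without cancellation; column-sparsity is used at ONE place, unique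
completion (`monoOfO_injOn`).  Here the same is proved under the weaker hypothesis that the FREE
GRAPH of the template — template columns `k` versus template rows `j`, an edge for every NON-ZERO
CONSTANT entry `E j k` — is ACYCLIC:
* §1 the free graph in its two spellings (`freeRel_eq`) and second support entries of the dart
  matrix of a closed walk (zero row and column sums, `RelationGraphCycles`);
* §2 `forest_of_colSparse`: column-sparse non-zero constants have an acyclic free graph (a cycle
  would put two non-zero constants into one template column), so rung 1″ ⊆ rung 1‴;
* §3 `monoOfO_injOn_forest` (UNIQUE COMPLETION): admissible `σ ≠ τ` with the same monomial agree
  on labelled cells (read-once); both are admissible for the comparison relation «common cells,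
  or free cells off the labelled cells of `σ`», whose relation graph is acyclic — the support
  entries of a cycle are free cells (a labelled common cell `(k, σ k)` on a cycle would need a
  second support entry in template row `σ k`, excluded), so the cycle would TRANSFER
  (`IsolationRoundsForest.exists_isCycle_transfer`) to the free graph — hence `σ = τ` by
  `perm_unique_of_forall_not_isCycle` BY NAME;
* §4 `monoOfO_mem_support_forest`: no cancellation.
Currency: kernel-certified helper for the W4 isolation road (O-L2-20); closes no item; no data
defs, no facts/doors.
-/

set_option linter.dupNamespace false

namespace Summit.ValiantsHypothesis.ValiantsHypothesis.Theorems.ReadOnceForestSupport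

open MvPolynomial SimpleGraph
  Summit.ValiantsHypothesis.ValiantsHypothesis.Theorems.ShortCyclePatterns
  Summit.ValiantsHypothesis.ValiantsHypothesis.Theorems.RelationGraphCycles
  Summit.ValiantsHypothesis.ValiantsHypothesis.Theorems.IsolationRoundsForest
  Summit.ValiantsHypothesis.ValiantsHypothesis.Theorems.ReadOnceColSparseSupport

variable {F : Type*} [Field F] {M : Type*} {r : ℕ}

/-! ### §1 The free graph of a template; second support entries -/

/-- The FREE GRAPH of a template in its two spellings: «admissible and unlabelled» (the form the
free-edge rounds see, `G₀ k j ∧ optLab E k j = none`) is «a non-zero constant» (the form of the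
family clause). [this file] -/
theorem freeRel_eq (E : Matrix (Fin r) (Fin r) (M ⊕ F)) :
    (fun k j => (∀ c : F, E j k = Sum.inr c → c ≠ 0) ∧ optLab E k j = none) =
      fun k j => ∃ c : F, E j k = Sum.inr c ∧ c ≠ 0 := by
  funext k j
  apply propext
  constructor
  · rintro ⟨hadm, hnone⟩
    obtain ⟨c, hc⟩ := (optLab_eq_none_iff E).1 hnone
    exact ⟨c, hc, hadm c hc⟩
  · rintro ⟨c, hc, hc0⟩
    refine ⟨fun c' hc' => ?_, (optLab_eq_none_iff E).2 ⟨c, hc⟩⟩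
    rw [hc] at hc'
    cases hc'
    exact hc0

/-- Zero ROW sums of the dart matrix of a closed walk: a support entry has a second support entry
with the same first index. [folklore] -/
theorem exists_ne_snd_of_walkSum_ne_zero {G : Fin r → Fin r → Prop} {u : Fin r ⊕ Fin r}
    (c : (relGraph G).Walk u u) {a b : Fin r} (h : walkSum dartMat c a b ≠ 0) :
    ∃ b', b' ≠ b ∧ walkSum dartMat c a b' ≠ 0 := by
  by_contra! h'
  have hrow := sum_walkSum_dartMat_row c a
  rw [Finset.sum_eq_single b (fun b' _ hb' => h' b' hb')
    (fun hb => absurd (Finset.mem_univ b) hb)] at hrow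
  exact h hrow

/-- Zero COLUMN sums of the dart matrix of a closed walk: a support entry has a second support
entry with the same second index. [folklore] -/
theorem exists_ne_fst_of_walkSum_ne_zero {G : Fin r → Fin r → Prop} {u : Fin r ⊕ Fin r}
    (c : (relGraph G).Walk u u) {a b : Fin r} (h : walkSum dartMat c a b ≠ 0) :
    ∃ a', a' ≠ a ∧ walkSum dartMat c a' b ≠ 0 := by
  by_contra! h'
  have hcol := sum_walkSum_dartMat_col c b
  rw [Finset.sum_eq_single a (fun a' _ ha' => h' a' ha')
    (fun ha => absurd (Finset.mem_univ a) ha)] at hcol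
  exact h hcol

/-! ### §2 Column-sparse ⇒ acyclic -/

/-- COLUMN-SPARSE non-zero constants have an ACYCLIC free graph: the dart matrix of a cycle is a
non-zero matrix with zero row sums, so some template column would hold two non-zero constants.
Hence rung 1″ (`readOnceColSparseDets`) ⊆ rung 1‴. [this file] -/
theorem forest_of_colSparse (E : Matrix (Fin r) (Fin r) (M ⊕ F))
    (hcs : ∀ (j j' k : Fin r) (c c' : F), E j k = Sum.inr c → E j' k = Sum.inr c' → c ≠ 0 →
      c' ≠ 0 → j = j') :
    ∀ (u : Fin r ⊕ Fin r) (c : (relGraph fun k j => ∃ c : F, E j k = Sum.inr c ∧ c ≠ 0).Walk u u),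
      ¬ c.IsCycle := by
  intro u c hc
  obtain ⟨i, j, hij⟩ : ∃ i j, walkSum dartMat c i j ≠ 0 := by
    by_contra! h
    exact walkSum_dartMat_ne_zero hc.isCircuit.isTrail hc.not_nil (Matrix.ext fun i j => h i j)
  obtain ⟨j', hne, hij'⟩ := exists_ne_snd_of_walkSum_ne_zero c hij
  obtain ⟨d, hd, hd0⟩ : ∃ d : F, E j i = Sum.inr d ∧ d ≠ 0 := rel_of_walkSum_dartMat_ne_zero c hij
  obtain ⟨d', hd', hd0'⟩ : ∃ d : F, E j' i = Sum.inr d ∧ d ≠ 0 :=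
    rel_of_walkSum_dartMat_ne_zero c hij'
  exact hne (hcs j' j i d' d hd' hd hd0' hd0)

/-! ### §3 Unique completion under an acyclic free graph -/

/-- UNIQUE COMPLETION, ACYCLIC VERSION.  If the variables of the template are READ-ONCE and its
free graph (admissible unlabelled cells = non-zero constants) is ACYCLIC, two admissible
permutations with the same monomial coincide. [this file] -/
theorem monoOfO_injOn_forest (E : Matrix (Fin r) (Fin r) (M ⊕ F))
    (hro : ∀ p q : Fin r × Fin r, ∀ m, E p.1 p.2 = Sum.inl m → E q.1 q.2 = Sum.inl m → p = q)
    (hfor : ∀ (u : Fin r ⊕ Fin r) (c : (relGraph fun k j =>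
      (∀ c : F, E j k = Sum.inr c → c ≠ 0) ∧ optLab E k j = none).Walk u u), ¬ c.IsCycle)
    {σ τ : Equiv.Perm (Fin r)} (hσ : ∀ k, ∀ c : F, E (σ k) k = Sum.inr c → c ≠ 0)
    (hτ : ∀ k, ∀ c : F, E (τ k) k = Sum.inr c → c ≠ 0)
    (h : monoOfO (optLab E) σ = monoOfO (optLab E) τ) : σ = τ := by
  -- a labelled cell pins its position (read-once): `τ` follows `σ` on the labelled cells of `σ`
  have key : ∀ {σ τ : Equiv.Perm (Fin r)}, monoOfO (optLab E) σ = monoOfO (optLab E) τ →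
      ∀ k, optLab E k (σ k) ≠ none → τ k = σ k := by
    intro σ τ h k hk
    obtain ⟨μ, hμ⟩ := Option.ne_none_iff_exists'.1 hk
    have hne : monoOfO (optLab E) τ μ ≠ 0 := by
      rw [← h]
      exact monoOfO_apply_ne_zero.2 ⟨k, hμ⟩
    obtain ⟨k', hk'⟩ := monoOfO_apply_ne_zero.1 hne
    have hpq := hro (σ k, k) (τ k', k') μ ((optLab_eq_some_iff E).1 hμ)
      ((optLab_eq_some_iff E).1 hk')
    simp only [Prod.mk.injEq] at hpq
    obtain ⟨hst, rfl⟩ := hpq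
    exact hst.symm
  -- the COMPARISON RELATION: common cells, or free cells off the labelled cells of `σ`
  refine perm_unique_of_forall_not_isCycle
    (fun k j => (j = σ k ∧ j = τ k) ∨ ((∀ c : F, E j k = Sum.inr c → c ≠ 0) ∧
      optLab E k j = none ∧ ∀ k', optLab E k' (σ k') ≠ none → j ≠ σ k')) ?_ ?_ ?_
  · -- its relation graph is acyclic: the support entries of a cycle are free cells …
    intro u c hc
    have hfree : ∀ a b, walkSum dartMat c a b ≠ 0 →
        (∀ d : F, E b a = Sum.inr d → d ≠ 0) ∧ optLab E a b = none := by
      intro a b hab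
      rcases rel_of_walkSum_dartMat_ne_zero c hab with ⟨hσa, -⟩ | ⟨hadm, hfr, -⟩
      · refine ⟨fun d hd => hσ a d (by rw [← hσa]; exact hd), ?_⟩
        -- a labelled common cell `(a, σ a)` on the cycle needs a second support entry in
        -- template row `σ a` (zero column sums) — a cell of neither kind
        by_contra hl
        obtain ⟨a', ha', hab'⟩ := exists_ne_fst_of_walkSum_ne_zero c hab
        rcases rel_of_walkSum_dartMat_ne_zero c hab' with ⟨hσa', -⟩ | ⟨-, -, hex⟩
        · exact ha' (σ.injective (hσa'.symm.trans hσa))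
        · exact hex a (by rw [← hσa]; exact hl) hσa
      · exact ⟨hadm, hfr⟩
    -- … so the cycle transfers to the free graph
    obtain ⟨c', hc', -⟩ := exists_isCycle_transfer
      (G' := fun k j => (∀ c : F, E j k = Sum.inr c → c ≠ 0) ∧ optLab E k j = none) hc hfree
    exact hfor u c' hc'
  · -- `σ` is admissible for the comparison relation
    intro k
    by_cases hl : optLab E k (σ k) = none
    · by_cases he : σ k = τ k
      · exact Or.inl ⟨rfl, he⟩
      · refine Or.inr ⟨hσ k, hl, fun k' hk' hkk => ?_⟩
        obtain rfl : k = k' := σ.injective hkk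
        exact hk' hl
    · exact Or.inl ⟨rfl, (key h k hl).symm⟩
  · -- `τ` is admissible for the comparison relation
    intro k
    by_cases he : σ k = τ k
    · exact Or.inl ⟨he.symm, rfl⟩
    · have hlτ : optLab E k (τ k) = none := by
        by_contra hl
        exact he (key h.symm k hl)
      refine Or.inr ⟨hτ k, hlτ, fun k' hk' hkk => ?_⟩
      have h1 : τ k' = σ k' := key h k' hk'
      obtain rfl : k = k' := τ.injective (hkk.trans h1.symm)
      exact he h1.symm

/-! ### §4 No cancellation -/

/-- No cancellation, acyclic version: the monomial of an admissible permutation is in the support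
of the determinant, with coefficient `sign σ · ∏ constants met ≠ 0`. [this file] -/
theorem monoOfO_mem_support_forest (E : Matrix (Fin r) (Fin r) (M ⊕ F))
    (hro : ∀ p q : Fin r × Fin r, ∀ m, E p.1 p.2 = Sum.inl m → E q.1 q.2 = Sum.inl m → p = q)
    (hfor : ∀ (u : Fin r ⊕ Fin r) (c : (relGraph fun k j =>
      (∀ c : F, E j k = Sum.inr c → c ≠ 0) ∧ optLab E k j = none).Walk u u), ¬ c.IsCycle)
    {σ : Equiv.Perm (Fin r)} (hσ : ∀ k, ∀ c : F, E (σ k) k = Sum.inr c → c ≠ 0) :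
    monoOfO (optLab E) σ ∈ (E.map (Sum.elim MvPolynomial.X MvPolynomial.C)).det.support := by
  classical
  rw [MvPolynomial.mem_support_iff, coeff_det_eq E, Finset.sum_eq_single σ]
  · refine mul_ne_zero ?_ (prodConst_ne_zero hσ)
    rcases Int.units_eq_one_or (Equiv.Perm.sign σ) with h | h <;> simp [h]
  · intro τ hτ hne
    rw [Finset.mem_filter] at hτ
    by_cases hτa : ∀ k, ∀ c : F, E (τ k) k = Sum.inr c → c ≠ 0
    · exact absurd (monoOfO_injOn_forest E hro hfor hτa hσ hτ.2) hne
    · rw [prodConst_eq_zero hτa, mul_zero]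
  · intro h
    exact (h (Finset.mem_filter.2 ⟨Finset.mem_univ _, rfl⟩)).elim

end Summit.ValiantsHypothesis.ValiantsHypothesis.Theorems.ReadOnceForestSupport
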